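import Summits.HubbardSuperconductivity.HubbardLadder.Bounds.TwistInsensitivityCluster
import HarnessLib

/-!
# Twist insensitivity of the grand-canonical `t–t'` Hubbard torus at high temperature:
# thermodynamic-limit form (pub-hubbard BOUNDS, bounds.tex Theorem 12 (ii)/(v) reading, tree constants)

HONEST FRAMING (cell pub-hubbard): ladder R1–R4 with certified numbers; no claim on H/H₀. This file
is a BOUND FOR A MODEL CLASS (the seam-twisted `t–t'` Hubbard torus at very high temperature); it
makes no materials claim. LEAN FILING REQUEST #181.7 (bounds g23); imports #181.6
(`TwistInsensitivityCluster`).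

## What is proved (0 sorry)

#181.6 gives, for every `L ≥ 3`, `|log Z_L(0) - log Z_L(θ)| ≤ 2 L² e^{-L}` and
`ρ_s ≤ 2 L² e^{-L}/(β θ₀²)` in the tree's Kotecký–Preiss window `s = |β|(2+2|t'|) ≤ 1`,
`65² e⁶ s ≤ 1/2`. Here the elementary limit `2 L² e^{-L} → 0` (`tendsto_two_mul_sq_mul_exp_neg`,
from Mathlib's `Real.tendsto_pow_mul_exp_neg_atTop_nhds_zero`) is taken, giving the
THERMODYNAMIC-LIMIT statements in `ε–L₀` form, with `L₀` depending on `ε` ONLY — i.e. uniformly in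
`t', U, μ, θ` and in `β` inside the window:

* `HighTemperatureTwistInsensitivityTT'ClusterTL` (proved): `∀ ε > 0 ∃ L₀ ∀ L ≥ L₀`, for all
  `t', U, μ, β` in the window and all `θ`: `|log Z_L(0) - log Z_L(θ)| ≤ ε`;
* `HighTemperatureNoThermalStiffnessTT'ClusterTL` (proved): `∀ β > 0, θ₀ > 0, ε > 0 ∃ L₀ ∀ L ≥ L₀`, for
  all `t', U, μ` with `β` in the window, every flux stiffness `ρ_s` of the grand-canonical free energy
  on `|θ| ≤ θ₀` satisfies `ρ_s ≤ ε` — NO thermal phase stiffness survives the thermodynamic limit.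

Same honest limits as #181.6: the window (`β(2+2|t'|) ≤ 2.93·10⁻⁷`, units `t = 1`) is the tree's, not
the paper's `T ≥ 160(|t|+|t'|)`; grand-canonical ensemble.

References: as in #181.6 — [KoteckyPreiss1986] Thm p. 492; [Ueltschi1999] §2.3, §3
(arXiv:cond-mat/9810320); [ScalapinoWhiteZhang1993] (flux / superfluid weight); [XuEtAl2024] eq. (1).
-/

noncomputable section

namespace Summit.HubbardSuperconductivity.HubbardLadder.Bounds

open Filter Topology Matrix Literature.MathematicalPhysics.QuantumLattice

/-- `2 L² e^{-L} → 0` along the naturals. [Mathlib `Real.tendsto_pow_mul_exp_neg_atTop_nhds_zero`] -/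
theorem tendsto_two_mul_sq_mul_exp_neg :
    Tendsto (fun L : ℕ => 2 * (L : ℝ) ^ 2 * Real.exp (-(L : ℝ))) atTop (𝓝 0) := by
  have h := ((Real.tendsto_pow_mul_exp_neg_atTop_nhds_zero 2).comp
    tendsto_natCast_atTop_atTop).const_mul 2
  rw [mul_zero] at h
  convert h using 1
  funext L
  simp only [Function.comp_apply]
  ring

/-- For every `ε > 0` there is `L₀ ≥ 3` with `2 L² e^{-L} ≤ ε` for all `L ≥ L₀`. [this file] -/
theorem exists_forall_two_mul_sq_mul_exp_neg_le {ε : ℝ} (hε : 0 < ε) :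
    ∃ L₀ : ℕ, 3 ≤ L₀ ∧ ∀ L : ℕ, L₀ ≤ L → 2 * (L : ℝ) ^ 2 * Real.exp (-(L : ℝ)) ≤ ε := by
  have h := tendsto_two_mul_sq_mul_exp_neg
  rw [Metric.tendsto_atTop] at h
  obtain ⟨N, hN⟩ := h ε hε
  refine ⟨max N 3, le_max_right _ _, fun L hL => ?_⟩
  have hd := hN L (le_trans (le_max_left _ _) hL)
  rw [Real.dist_eq, sub_zero, abs_of_nonneg (by positivity)] at hd
  exact hd.le

/-! ### Nodes (thermodynamic-limit form) -/

/-- **Node (PROVED below): twist insensitivity in the thermodynamic limit, tree constants.** For every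
`ε > 0` there is `L₀` (depending on `ε` only) such that for all `L ≥ L₀`, all real `t', U, μ, β` with
`|β|(2+2|t'|) ≤ 1` and `65² e⁶ |β|(2+2|t'|) ≤ 1/2`, and every seam twist `θ`:
`|log Re Z_L(0) - log Re Z_L(θ)| ≤ ε`, `Z_L(θ) = partitionFn β (hubbardTorusTT'FluxMu L t' U μ θ)`.
[programme node: bounds.tex §12 Thm 12 (i)/(v), L → ∞; cites KoteckyPreiss1986, Ueltschi1999] -/
@[conjecture] def HighTemperatureTwistInsensitivityTT'ClusterTL : Prop :=
  ∀ ε : ℝ, 0 < ε → ∃ L₀ : ℕ, ∀ (L : ℕ) [NeZero L], L₀ ≤ L → ∀ (t' U μ β θ : ℝ),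
    |β| * (2 + 2 * |t'|) ≤ 1 →
    (65 : ℝ) ^ 2 * (Real.exp 6 * (|β| * (2 + 2 * |t'|))) ≤ 1 / 2 →
      |Real.log (partitionFn β (hubbardTorusTT'FluxMu L t' U μ 0)).re -
          Real.log (partitionFn β (hubbardTorusTT'FluxMu L t' U μ θ)).re| ≤ ε

/-- PROOF of the node `HighTemperatureTwistInsensitivityTT'ClusterTL`. [this file] -/
theorem highTemperatureTwistInsensitivityTT'ClusterTL_holds :
    HighTemperatureTwistInsensitivityTT'ClusterTL := by
  intro ε hε
  obtain ⟨L₀, hL₀3, hL₀⟩ := exists_forall_two_mul_sq_mul_exp_neg_le hε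
  refine ⟨L₀, fun L _ hL t' U μ β θ hs1 hsmall => ?_⟩
  exact (abs_log_partitionFn_twist_sub_le (le_trans hL₀3 hL) t' U μ β θ hs1 hsmall).trans (hL₀ L hL)

/-- **Node (PROVED below): no thermal phase stiffness in the thermodynamic limit, tree constants.**
For every `β > 0`, `θ₀ > 0` and `ε > 0` there is `L₀` such that for all `L ≥ L₀` and all real
`t', U, μ` with `|β|(2+2|t'|) ≤ 1`, `65² e⁶ |β|(2+2|t'|) ≤ 1/2`: every flux stiffness `ρ_s` of the
grand-canonical free energy (`β ρ_s θ² ≤ log Re Z_L(0) - log Re Z_L(θ)` for `|θ| ≤ θ₀`) obeys `ρ_s ≤ ε`.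
[programme node: bounds.tex §12 Thm 12 (ii)/(v), L → ∞; cites ScalapinoWhiteZhang1993] -/
@[conjecture] def HighTemperatureNoThermalStiffnessTT'ClusterTL : Prop :=
  ∀ (β θ₀ ε : ℝ), 0 < β → 0 < θ₀ → 0 < ε → ∃ L₀ : ℕ, ∀ (L : ℕ) [NeZero L], L₀ ≤ L →
    ∀ (t' U μ ρs : ℝ),
      |β| * (2 + 2 * |t'|) ≤ 1 →
      (65 : ℝ) ^ 2 * (Real.exp 6 * (|β| * (2 + 2 * |t'|))) ≤ 1 / 2 →
      (∀ θ : ℝ, |θ| ≤ θ₀ → β * ρs * θ ^ 2 ≤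
          Real.log (partitionFn β (hubbardTorusTT'FluxMu L t' U μ 0)).re -
            Real.log (partitionFn β (hubbardTorusTT'FluxMu L t' U μ θ)).re) →
      ρs ≤ ε

/-- PROOF of the node `HighTemperatureNoThermalStiffnessTT'ClusterTL`: choose `L₀` for
`ε · β θ₀²` and use #181.6's finite-`L` bound. [this file] -/
theorem highTemperatureNoThermalStiffnessTT'ClusterTL_holds :
    HighTemperatureNoThermalStiffnessTT'ClusterTL := by
  intro β θ₀ ε hβ hθ₀ hε
  have hpos : 0 < β * θ₀ ^ 2 := mul_pos hβ (pow_pos hθ₀ 2)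
  obtain ⟨L₀, hL₀3, hL₀⟩ := exists_forall_two_mul_sq_mul_exp_neg_le (mul_pos hε hpos)
  refine ⟨L₀, fun L _ hL t' U μ ρs hs1 hsmall hstiff => ?_⟩
  have h := highTemperatureNoThermalStiffnessTT'Cluster_holds L (le_trans hL₀3 hL) t' U μ β ρs θ₀
    hβ hθ₀ hs1 hsmall hstiff
  calc ρs ≤ 2 * (L : ℝ) ^ 2 * Real.exp (-(L : ℝ)) / (β * θ₀ ^ 2) := h
    _ ≤ ε * (β * θ₀ ^ 2) / (β * θ₀ ^ 2) := div_le_div_of_nonneg_right (hL₀ L hL) hpos.le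
    _ = ε := mul_div_cancel_right₀ ε hpos.ne'

end Summit.HubbardSuperconductivity.HubbardLadder.Bounds

end
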